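import Mathlib
import Summits.ValiantsHypothesis.ValiantsHypothesis.Theorems.FifoMatchingNFPolytopeQueueGridGadgetDefs
import HarnessLib

/-!
# Route `FifoMatching`, item `NFPolytopeQuasiPolyXC` (K1, stmt-26254), line `queue_grid_face`, INPUT (A):
# layout-B positions — `QPos.toFin` / `QPos.ofFin` are inverse bijections `QPos r d ≃ Fin (2 · half r d)`

Bookkeeping for `FifoMatchingNFPolytopeQueueGridGadgetDefs.lean`: decoding is a two-sided inverse of the position map
(`ofFin_toFin`, `toFin_ofFin`), so every position of the word is a symbolic position (`exists_toFin_eq`);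
the design word read at a symbolic position is its symbolic letter (`word_toFin`); and the symbolic predecessor sits one
to the left (`toNat_predQ`).  Elementary arithmetic (`/`, `%` by `4r+2` and `4`); nothing here bears on K1 or VP ≠ VNP.
-/

-- Sub = Summit single-conjunct layout: the duplicated namespace component is mandated by the tree.
set_option linter.dupNamespace false

namespace Summit.ValiantsHypothesis.ValiantsHypothesis.Theorems.FifoMatching.NFPolytopeQuasiPolyXC.QueueGridFace

namespace QPos

variable {r d : ℕ}

/-- arithmetic: `(s-1)c + c = sc` for `s ≥ 1` -/
theorem pred_mul_add {s : ℕ} (hs : 0 < s) (c : ℕ) : (s - 1) * c + c = s * c := by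
  obtain ⟨s, rfl⟩ := Nat.exists_eq_succ_of_ne_zero hs.ne'
  simp [Nat.succ_mul]

/-- The position of a decoded stretch offset `q` is `(2r+1) + q`. -/
theorem toNat_ofStretch (q : ℕ) (hq : q < r * (4 * r + 2)) : (ofStretch (d := d) q hq).toNat = (2 * r + 1) + q := by
  have key : q / (4 * r + 2) * (4 * r + 2) + q % (4 * r + 2) = q := by
    rw [Nat.mul_comm]; exact Nat.div_add_mod q _
  have key2 := Nat.div_add_mod (q % (4 * r + 2) - 1) 4
  unfold ofStretch
  split_ifs with h0 h1
  · simp only [toNat]; omega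
  · simp only [toNat]; omega
  · simp only [toNat]
    generalize q / (4 * r + 2) * (4 * r + 2) = P at key ⊢
    omega

/-- `toFin ∘ ofFin = id`. -/
theorem toFin_ofFin (p : Fin (2 * half r d)) : (ofFin p).toFin = p := by
  apply Fin.ext
  simp only [toFin]
  have hsq := sq_eq r
  have h2 := two_mul_eq r
  unfold ofFin
  split_ifs with h₁ h₂ h₃
  · simp [toNat]
  · rw [toNat_ofStretch]; omega
  · simp only [toNat]
    generalize (2 * r + 1) * (2 * r + 1) = Q at hsq h₃ ⊢
    generalize r * (4 * r + 2) = A at hsq h₂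
    omega
  · simp only [toNat]
    generalize (2 * r + 1) * (2 * r + 1) = Q at hsq h2 h₃ ⊢
    generalize r * (4 * r + 2) = A at hsq h₂
    generalize (r + 1) * (2 * r + 1) = H at h2 ⊢
    omega

/-- Decoding the offset of a frame `U`. -/
theorem ofStretch_frU (s : Fin r) (hq : s.val * (4 * r + 2) < r * (4 * r + 2)) :
    ofStretch (d := d) (s.val * (4 * r + 2)) hq = frU s := by
  have hpos : 0 < 4 * r + 2 := by omega
  unfold ofStretch
  rw [dif_pos (Nat.mul_mod_left _ _)]
  congr 1
  exact Fin.ext (Nat.mul_div_cancel _ hpos)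

/-- Decoding the offset of an in-stretch letter `s(4r+2) + c`, `0 < c < 4r+2`: quotient and remainder. -/
theorem div_mod_stretch (s : Fin r) (c : ℕ) (hc : c < 4 * r + 2) :
    (s.val * (4 * r + 2) + c) / (4 * r + 2) = s ∧ (s.val * (4 * r + 2) + c) % (4 * r + 2) = c := by
  have hpos : 0 < 4 * r + 2 := by omega
  constructor
  · rw [Nat.mul_comm, Nat.mul_add_div hpos, Nat.div_eq_of_lt hc, Nat.add_zero]
  · rw [Nat.mul_comm, Nat.mul_add_mod, Nat.mod_eq_of_lt hc]

/-- Decoding the offset of a frame `D`. -/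
theorem ofStretch_frD (s : Fin r) (hq : s.val * (4 * r + 2) + (4 * r + 1) < r * (4 * r + 2)) :
    ofStretch (d := d) (s.val * (4 * r + 2) + (4 * r + 1)) hq = frD s := by
  obtain ⟨hdiv, hmod⟩ := div_mod_stretch s (4 * r + 1) (by omega)
  unfold ofStretch
  rw [dif_neg (by omega), dif_pos hmod]
  congr 1
  exact Fin.ext hdiv

/-- Decoding the offset of a window slot. -/
theorem ofStretch_slot (s i : Fin r) (t : Fin 4)
    (hq : s.val * (4 * r + 2) + (4 * i + t + 1) < r * (4 * r + 2)) :
    ofStretch (d := d) (s.val * (4 * r + 2) + (4 * i + t + 1)) hq = slot s i t := by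
  have hi := i.isLt; have ht := t.isLt
  obtain ⟨hdiv, hmod⟩ := div_mod_stretch s (4 * i + t + 1) (by omega)
  unfold ofStretch
  rw [dif_neg (by omega), dif_neg (by omega)]
  congr 1
  · exact Fin.ext hdiv
  · apply Fin.ext; simp only [hmod]; omega
  · apply Fin.ext; simp only [hmod]; omega

/-- `ofFin ∘ toFin = id`. -/
theorem ofFin_toFin (x : QPos r d) : ofFin x.toFin = x := by
  have hsq := sq_eq r
  have h2 := two_mul_eq r
  cases x with
  | pre j =>
    unfold ofFin
    rw [dif_pos (by simp only [toFin, toNat]; exact j.isLt)]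
    rfl
  | frU s =>
    have hst := stretch_le (r := r) s.isLt
    unfold ofFin
    rw [dif_neg (by simp only [toFin, toNat]; omega), dif_pos (by simp only [toFin, toNat]; omega)]
    have e : (frU s : QPos r d).toFin.val - (2 * r + 1) = s.val * (4 * r + 2) := by
      simp only [toFin, toNat]; omega
    simp only [e]
    exact ofStretch_frU s _
  | slot s i t =>
    have hst := stretch_le (r := r) s.isLt
    have hi := i.isLt; have ht := t.isLt
    unfold ofFin
    rw [dif_neg (by simp only [toFin, toNat]; omega), dif_pos (by simp only [toFin, toNat]; omega)]
    have e : (slot s i t : QPos r d).toFin.val - (2 * r + 1) = s.val * (4 * r + 2) + (4 * i + t + 1) := by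
      simp only [toFin, toNat]; omega
    simp only [e]
    exact ofStretch_slot s i t _
  | frD s =>
    have hst := stretch_le (r := r) s.isLt
    unfold ofFin
    rw [dif_neg (by simp only [toFin, toNat]; omega), dif_pos (by simp only [toFin, toNat]; omega)]
    have e : (frD s : QPos r d).toFin.val - (2 * r + 1) = s.val * (4 * r + 2) + (4 * r + 1) := by
      simp only [toFin, toNat]; omega
    simp only [e]
    exact ofStretch_frD s _
  | post j =>
    have hj := j.isLt
    unfold ofFin
    rw [dif_neg ?_, dif_neg ?_, dif_pos ?_]
    · simp [toFin, toNat]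
    · simp only [toFin, toNat]; omega
    · simp only [toFin, toNat]
      generalize (2 * r + 1) * (2 * r + 1) = Q at hsq ⊢
      generalize r * (4 * r + 2) = A at hsq ⊢
      omega
    · simp only [toFin, toNat]
      generalize (2 * r + 1) * (2 * r + 1) = Q at hsq ⊢
      omega
  | pad j =>
    have hj := j.isLt
    unfold ofFin
    rw [dif_neg ?_, dif_neg ?_, dif_neg ?_]
    · simp [toFin, toNat]
    · simp only [toFin, toNat]
      generalize (2 * r + 1) * (2 * r + 1) = Q at hsq h2 ⊢
      generalize (r + 1) * (2 * r + 1) = H at h2 ⊢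
      omega
    · simp only [toFin, toNat]
      generalize (2 * r + 1) * (2 * r + 1) = Q at hsq h2 ⊢
      generalize (r + 1) * (2 * r + 1) = H at h2 ⊢
      generalize r * (4 * r + 2) = A at hsq ⊢
      omega
    · simp only [toFin, toNat]
      generalize (2 * r + 1) * (2 * r + 1) = Q at hsq h2 ⊢
      generalize (r + 1) * (2 * r + 1) = H at h2 ⊢
      omega

/-- `toFin` is injective (with `ofFin` it is a bijection `QPos r d ≃ Fin (2 · half r d)`). -/
theorem toFin_injective : Function.Injective (toFin : QPos r d → Fin (2 * half r d)) :=
  fun x y h => by rw [← ofFin_toFin x, ← ofFin_toFin y, h]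

/-- Two symbolic positions with the same position are equal. -/
theorem toNat_injective : Function.Injective (toNat : QPos r d → ℕ) :=
  fun _ _ h => toFin_injective (Fin.ext h)

/-- Every position is (uniquely) a symbolic position. -/
theorem exists_toFin_eq (p : Fin (2 * half r d)) : ∃ x : QPos r d, x.toFin = p := ⟨ofFin p, toFin_ofFin p⟩

/-- Comparing positions of symbolic positions. -/
@[simp] theorem toFin_lt_toFin {x y : QPos r d} : x.toFin < y.toFin ↔ x.toNat < y.toNat := Iff.rfl

/-- Comparing positions of symbolic positions. -/
@[simp] theorem toFin_le_toFin {x y : QPos r d} : x.toFin ≤ y.toFin ↔ x.toNat ≤ y.toNat := Iff.rfl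

/-- Equality of positions of symbolic positions. -/
@[simp] theorem toFin_inj {x y : QPos r d} : x.toFin = y.toFin ↔ x = y := toFin_injective.eq_iff

/-- The value of `toFin`. -/
@[simp] theorem toFin_val (x : QPos r d) : x.toFin.val = x.toNat := rfl

/-! ### Equations of the symbolic predecessor -/

section PredQ
variable (s i : Fin r) (t : Fin 4)

/-- predecessor of a preamble letter -/
theorem predQ_pre (j : Fin (2 * r + 1)) :
    predQ (pre j : QPos r d) = pre ⟨j.val - 1, by have := j.isLt; omega⟩ := rfl

/-- predecessor of the first frame `U` is the last preamble letter -/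
theorem predQ_frU_zero (h : s.val = 0) : predQ (frU s : QPos r d) = pre ⟨2 * r, by omega⟩ := dif_pos h

/-- predecessor of a later frame `U` is the previous frame `D` -/
theorem predQ_frU_ne (h : s.val ≠ 0) :
    predQ (frU s : QPos r d) = frD ⟨s.val - 1, by have := s.isLt; omega⟩ := dif_neg h

/-- predecessor of slot `0` of window `0` is the frame `U` -/
theorem predQ_slot_zero_zero (ht : t.val = 0) (hi : i.val = 0) : predQ (slot s i t : QPos r d) = frU s := by
  show (if t.val = 0 then _ else _) = _
  rw [if_pos ht, dif_pos hi]

/-- predecessor of slot `0` of a later window is slot `3` of the previous window -/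
theorem predQ_slot_zero_ne (ht : t.val = 0) (hi : i.val ≠ 0) :
    predQ (slot s i t : QPos r d) = slot s ⟨i.val - 1, by have := i.isLt; omega⟩ 3 := by
  show (if t.val = 0 then _ else _) = _
  rw [if_pos ht, dif_neg hi]

/-- predecessor of a later slot is the previous slot -/
theorem predQ_slot_ne (ht : t.val ≠ 0) :
    predQ (slot s i t : QPos r d) = slot s i ⟨t.val - 1, by have := t.isLt; omega⟩ := if_neg ht

/-- predecessor of a frame `D` is slot `3` of the last window -/
theorem predQ_frD : predQ (frD s : QPos r d) = slot s ⟨r - 1, by have := s.isLt; omega⟩ 3 := rfl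

/-- predecessor of the first postamble letter is the last frame `D` (when `r ≥ 1`) -/
theorem predQ_post_zero (j : Fin (2 * r + 1)) (hj : j.val = 0) (hr : 0 < r) :
    predQ (post j : QPos r d) = frD ⟨r - 1, by omega⟩ := by
  show (if j.val = 0 then _ else _) = _
  rw [if_pos hj, dif_pos hr]

/-- predecessor of the first postamble letter when `r = 0` (degenerate: the one preamble letter) -/
theorem predQ_post_zero_zero (j : Fin (2 * r + 1)) (hj : j.val = 0) (hr : ¬ 0 < r) :
    predQ (post j : QPos r d) = pre ⟨2 * r, by omega⟩ := by
  show (if j.val = 0 then _ else _) = _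
  rw [if_pos hj, dif_neg hr]

/-- predecessor of a later postamble letter -/
theorem predQ_post_ne (j : Fin (2 * r + 1)) (hj : j.val ≠ 0) :
    predQ (post j : QPos r d) = post ⟨j.val - 1, by have := j.isLt; omega⟩ := if_neg hj

/-- predecessor of the first padding letter is the last postamble letter -/
theorem predQ_pad_zero (j : Fin (2 * d)) (hj : j.val = 0) : predQ (pad j : QPos r d) = post ⟨2 * r, by omega⟩ :=
  if_pos hj

/-- predecessor of a later padding letter -/
theorem predQ_pad_ne (j : Fin (2 * d)) (hj : j.val ≠ 0) :
    predQ (pad j : QPos r d) = pad ⟨j.val - 1, by have := j.isLt; omega⟩ := if_neg hj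

end PredQ

/-- The symbolic predecessor is one position to the left (away from position `0`). -/
theorem toNat_predQ (x : QPos r d) (hx : x.toNat ≠ 0) : (predQ x).toNat + 1 = x.toNat := by
  have hsq := sq_eq r
  have h2 := two_mul_eq r
  cases x with
  | pre j => simp only [predQ, toNat] at hx ⊢; omega
  | frU s =>
    simp only [predQ]
    by_cases h : s.val = 0
    · rw [dif_pos h]; simp only [toNat, h]; ring
    · rw [dif_neg h]; simp only [toNat]
      have := pred_mul_add (Nat.pos_of_ne_zero h) (4 * r + 2)
      omega
  | slot s i t =>
    simp only [predQ]
    by_cases ht : t.val = 0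
    · rw [if_pos ht]
      by_cases hi : i.val = 0
      · rw [dif_pos hi]; simp only [toNat, ht, hi]
      · rw [dif_neg hi]; simp only [toNat]; omega
    · rw [if_neg ht]; simp only [toNat]; omega
  | frD s => have := s.isLt; simp only [predQ, toNat]; omega
  | post j =>
    simp only [predQ]
    by_cases hj : j.val = 0
    · rw [if_pos hj]
      by_cases hr : 0 < r
      · rw [dif_pos hr]; simp only [toNat, hj]
        have := pred_mul_add hr (4 * r + 2)
        generalize (2 * r + 1) * (2 * r + 1) = Q at hsq ⊢
        omega
      · rw [dif_neg hr]; simp only [toNat, hj]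
        have hr0 : r = 0 := by omega
        subst hr0; norm_num
    · rw [if_neg hj]; simp only [toNat]; omega
  | pad j =>
    simp only [predQ]
    by_cases hj : j.val = 0
    · rw [if_pos hj]; simp only [toNat, hj]
      generalize (2 * r + 1) * (2 * r + 1) = Q at hsq h2 ⊢
      omega
    · rw [if_neg hj]; simp only [toNat]; omega

end QPos

/-- **The design word read at a symbolic position is its symbolic letter.** -/
@[simp] theorem word_toFin {r d : ℕ} (X : Fin r × Fin r → Bool) (x : QPos r d) :
    word d X x.toFin = QPos.isU X x := by
  simp [word, QPos.ofFin_toFin]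

/-- Membership in the allowed-arc set, at symbolic positions. -/
@[simp] theorem mem_allowed_iff {r d : ℕ} (x y : QPos r d) :
    (x.toFin, y.toFin) ∈ allowed r d ↔ QPos.adj x y = true := by
  simp [allowed, QPos.ofFin_toFin]

end Summit.ValiantsHypothesis.ValiantsHypothesis.Theorems.FifoMatching.NFPolytopeQuasiPolyXC.QueueGridFace
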